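import Mathlib
import HarnessLib

/-!
# A discrete `ℓ¹`-Poincaré inequality on the two-dimensional torus, and an extensive
# intermediate level set for slowly varying densities

Topic `Probability/LatticeModels` (discrete tori); proof-only, elementary.  Written for route
`HubbardSuperconductivity/ParityGapRigidity` (crux `GappedWindow`, stmt-HubbardSuperconductivity-2196):
there the Bloch occupations `n_k ∈ [0,1]` of a sector ground state in a parity-gapped window are
`K/L`-Lipschitz on the dual torus `(ℤ/Lℤ)²` (`MomentumDistributionLipschitz`), sum to the particle
number `≈ (1-δ)L²/2`, and the question is whether the "momentum smearing" `Σ_k n_k(1-n_k)` is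
extensive.  It is, by the following two facts about real functions on `(ℤ/Lℤ)²`
(written on `ZMod L × ZMod L`; the transfer to `Fin 2 → ZMod L` is `sum_mul_one_sub_ge_of_lipschitz_pi`).

* `abs_sub_le_cycleVariation` — on the cycle `ℤ/Lℤ`, `|g j - g i| ≤ Σ_s |g(s+1) - g(s)|`
  (telescoping along the arc from `i` to `j`);
* `torusSq_sum_abs_sub_mean_le` — **`ℓ¹`-Poincaré on `(ℤ/Lℤ)²`**:
  `Σ_p |g p - ḡ| ≤ L · (Σ_p |g(p + e₁) - g p| + Σ_p |g(p + e₂) - g p|)`, `ḡ` the mean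
  (two-step paths row-then-column and the cycle bound; constant `L`, the sharp constant is `L/4`);
* `sum_mul_one_sub_ge_of_lipschitz` — **extensive intermediate level set**: if `0 ≤ f ≤ 1`,
  `L²/8 ≤ Σ_p f p ≤ L²/2`, and `|f(p + eᵢ) - f p| ≤ K/L` on every edge with `0 ≤ K`, `2K ≤ L`, then
  `Σ_p f p (1 - f p) ≥ L² / (1502 K + 256)`.
  Proof: clamp `f` to `[1/16, 3/4]`; the clamped function `g` varies only across edges touching
  the middle set `M = {1/16 < f < 3/4}` (an edge from `{f ≥ 3/4}` to `{f ≤ 1/16}` would jump by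
  `11/16 > K/L`), so its total variation is `≤ 4(K/L)|M|`; by Poincaré `Σ|g - ḡ| ≤ 4K|M|`; but
  `Σ|g - ḡ| ≥ (11/16)·min(|A|, |B|)` for the plateaux `A = {f ≥ 3/4}`, `B = {f ≤ 1/16}`, and particle
  counting gives `min(|A|,|B|) ≥ L²/15 - |M|`; hence `|M| ≥ L²/(88K + 15)` and on `M`,
  `f(1-f) ≥ 15/256`.

Everything is proved; no definitions, no named facts.  Sources: folklore (discrete Poincaré /
Cheeger inequalities on grids, e.g. F. Chung, *Spectral Graph Theory* (1997) Ch. 2; L. Saloff-Coste,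
*Lectures on finite Markov chains* (1997) §3.2, the "canonical paths" bound).

## Mathlib / tree search

Mathlib: `ZMod.natCast_zmod_val`, `ZMod.val_lt`, `ZMod.natCast_eq_natCast_iff'`, `Finset.sum_image`,
`Finset.sum_le_univ_sum_of_nonneg`, `Finset.abs_sum_le_sum_abs`, `Fintype.sum_prod_type`,
`abs_max_sub_max_le_abs`, `abs_min_sub_min_le_max`, `Equiv.sum_comp`, `finTwoArrowEquiv`.
Tree: nothing comparable (`rg "Poincare|Cheeger" Literature/Probability` finds only continuum facts).
-/

namespace Literature.Probability.LatticeModels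

open Finset

/-! ### Telescoping on the cycle `ℤ/Lℤ` -/

section Cycle

variable {L : ℕ} [NeZero L]

omit [NeZero L] in
/-- Telescoping along an arc of the cycle: `|g(i + n) - g(i)| ≤ Σ_{t<n} |g(i+t+1) - g(i+t)|`.
[folklore] -/
theorem abs_sub_le_sum_range_cycle (g : ZMod L → ℝ) (i : ZMod L) (n : ℕ) :
    |g (i + n) - g i| ≤ ∑ t ∈ Finset.range n, |g (i + t + 1) - g (i + t)| := by
  induction n with
  | zero => simp
  | succ n ih =>
    rw [Finset.sum_range_succ]
    have hc : (i + ((n + 1 : ℕ) : ZMod L)) = i + (n : ZMod L) + 1 := by push_cast; ring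
    rw [hc]
    calc |g (i + n + 1) - g i| = |(g (i + n + 1) - g (i + n)) + (g (i + n) - g i)| := by ring_nf
      _ ≤ |g (i + n + 1) - g (i + n)| + |g (i + n) - g i| := abs_add_le _ _
      _ ≤ _ := by linarith [ih]

/-- A sum of a non-negative function over an arc of length `n ≤ L` of the cycle is at most its sum
over the whole cycle (the arc visits distinct points). [folklore] -/
theorem sum_range_cycle_le (h : ZMod L → ℝ) (hh : ∀ s, 0 ≤ h s) (i : ZMod L) {n : ℕ} (hn : n ≤ L) :
    ∑ t ∈ Finset.range n, h (i + t) ≤ ∑ s : ZMod L, h s := by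
  have hinj : Set.InjOn (fun t : ℕ => i + (t : ZMod L)) (Finset.range n) := by
    intro t₁ ht₁ t₂ ht₂ heq
    have h1 : t₁ < L := lt_of_lt_of_le (Finset.mem_range.1 ht₁) hn
    have h2 : t₂ < L := lt_of_lt_of_le (Finset.mem_range.1 ht₂) hn
    have h12 : ((t₁ : ZMod L)) = (t₂ : ZMod L) := add_left_cancel heq
    rw [ZMod.natCast_eq_natCast_iff', Nat.mod_eq_of_lt h1, Nat.mod_eq_of_lt h2] at h12
    exact h12
  rw [← Finset.sum_image hinj]
  exact Finset.sum_le_univ_sum_of_nonneg hh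

/-- **Cycle bound**: on `ℤ/Lℤ`, `|g j - g i| ≤ Σ_s |g(s+1) - g(s)|` for all `i, j`. [folklore] -/
theorem abs_sub_le_cycleVariation (g : ZMod L → ℝ) (i j : ZMod L) :
    |g j - g i| ≤ ∑ s : ZMod L, |g (s + 1) - g s| := by
  have hj : j = i + ((j - i).val : ℕ) := by rw [ZMod.natCast_zmod_val]; ring
  calc |g j - g i| = |g (i + ((j - i).val : ℕ)) - g i| := by rw [← hj]
    _ ≤ ∑ t ∈ Finset.range (j - i).val, |g (i + t + 1) - g (i + t)| :=
        abs_sub_le_sum_range_cycle g i _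
    _ ≤ ∑ s : ZMod L, |g (s + 1) - g s| :=
        sum_range_cycle_le (fun s => |g (s + 1) - g s|) (fun s => abs_nonneg _) i (ZMod.val_lt (j - i)).le

end Cycle

/-! ### The `ℓ¹`-Poincaré inequality on `(ℤ/Lℤ)²` -/

section Poincare

variable {L : ℕ} [NeZero L]

/-- Two-step path bound: `|g(a,b) - g(a',b')| ≤ H_b + V_{a'}` with the row variation
`H_b = Σ_s |g(s+1,b) - g(s,b)|` and the column variation `V_{a'} = Σ_s |g(a',s+1) - g(a',s)|`.
[folklore] -/
theorem abs_sub_le_row_add_col (g : ZMod L × ZMod L → ℝ) (a b a' b' : ZMod L) :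
    |g (a, b) - g (a', b')| ≤
      (∑ s : ZMod L, |g (s + 1, b) - g (s, b)|) + ∑ s : ZMod L, |g (a', s + 1) - g (a', s)| := by
  have h1 : |g (a', b) - g (a, b)| ≤ ∑ s : ZMod L, |g (s + 1, b) - g (s, b)| :=
    abs_sub_le_cycleVariation (fun s => g (s, b)) a a'
  have h2 : |g (a', b') - g (a', b)| ≤ ∑ s : ZMod L, |g (a', s + 1) - g (a', s)| :=
    abs_sub_le_cycleVariation (fun s => g (a', s)) b b'
  calc |g (a, b) - g (a', b')| = |(g (a', b) - g (a, b)) + (g (a', b') - g (a', b))| := by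
        rw [abs_sub_comm]; ring_nf
    _ ≤ |g (a', b) - g (a, b)| + |g (a', b') - g (a', b)| := abs_add_le _ _
    _ ≤ _ := add_le_add h1 h2

/-- **`ℓ¹`-Poincaré inequality on the discrete torus `(ℤ/Lℤ)²`**: for every real function `g`,
`Σ_p |g p - ḡ| ≤ L · (Σ_p |g(p + e₁) - g p| + Σ_p |g(p + e₂) - g p|)`, `ḡ = L⁻² Σ_q g q`
(average the two-step path bound over the endpoint, then over the starting point).
Chung (1997) Ch. 2; Saloff-Coste (1997) §3.2. [folklore] -/
theorem torusSq_sum_abs_sub_mean_le (g : ZMod L × ZMod L → ℝ) :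
    ∑ p : ZMod L × ZMod L, |g p - (∑ q : ZMod L × ZMod L, g q) / (L : ℝ) ^ 2| ≤
      (L : ℝ) * ((∑ p : ZMod L × ZMod L, |g (p.1 + 1, p.2) - g p|) +
        ∑ p : ZMod L × ZMod L, |g (p.1, p.2 + 1) - g p|) := by
  classical
  have hL : (0 : ℝ) < L := Nat.cast_pos.2 (Nat.pos_of_ne_zero (NeZero.ne L))
  have hNpos : (0 : ℝ) < (L : ℝ) ^ 2 := by positivity
  have hcard : (Fintype.card (ZMod L × ZMod L) : ℝ) = (L : ℝ) ^ 2 := by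
    rw [Fintype.card_prod, ZMod.card]; push_cast; ring
  set H : ZMod L → ℝ := fun b => ∑ s : ZMod L, |g (s + 1, b) - g (s, b)| with hH
  set V : ZMod L → ℝ := fun a => ∑ s : ZMod L, |g (a, s + 1) - g (a, s)| with hV
  have hHsum : ∑ b : ZMod L, H b = ∑ p : ZMod L × ZMod L, |g (p.1 + 1, p.2) - g p| := by
    rw [Fintype.sum_prod_type, Finset.sum_comm]
  have hVsum : ∑ a : ZMod L, V a = ∑ p : ZMod L × ZMod L, |g (p.1, p.2 + 1) - g p| := by
    rw [Fintype.sum_prod_type]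
  -- pointwise bound `|g p - ḡ| ≤ H_{p.2} + Vtot / L`
  have hpt : ∀ p : ZMod L × ZMod L, |g p - (∑ q, g q) / (L : ℝ) ^ 2| ≤
      H p.2 + (∑ a : ZMod L, V a) / L := by
    rintro ⟨a, b⟩
    have hrepr : g (a, b) - (∑ q, g q) / (L : ℝ) ^ 2 =
        (∑ q : ZMod L × ZMod L, (g (a, b) - g q)) / (L : ℝ) ^ 2 := by
      rw [Finset.sum_sub_distrib, Finset.sum_const, Finset.card_univ, nsmul_eq_mul, hcard]
      field_simp
    rw [hrepr, abs_div, abs_of_pos hNpos, div_le_iff₀ hNpos]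
    calc |∑ q : ZMod L × ZMod L, (g (a, b) - g q)|
        ≤ ∑ q : ZMod L × ZMod L, |g (a, b) - g q| := Finset.abs_sum_le_sum_abs _ _
      _ ≤ ∑ q : ZMod L × ZMod L, (H b + V q.1) :=
          Finset.sum_le_sum fun q _ => abs_sub_le_row_add_col g a b q.1 q.2
      _ = (L : ℝ) ^ 2 * H b + L * ∑ a' : ZMod L, V a' := by
          rw [Finset.sum_add_distrib, Finset.sum_const, Finset.card_univ, nsmul_eq_mul, hcard,
            Fintype.sum_prod_type]
          simp only [Finset.sum_const, Finset.card_univ, ZMod.card, nsmul_eq_mul]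
          rw [← Finset.mul_sum]
      _ = (H b + (∑ a' : ZMod L, V a') / L) * (L : ℝ) ^ 2 := by
          field_simp
  calc ∑ p, |g p - (∑ q, g q) / (L : ℝ) ^ 2|
      ≤ ∑ p : ZMod L × ZMod L, (H p.2 + (∑ a : ZMod L, V a) / L) := Finset.sum_le_sum fun p _ => hpt p
    _ = L * ∑ b : ZMod L, H b + L * ∑ a : ZMod L, V a := by
        rw [Finset.sum_add_distrib, Finset.sum_const, Finset.card_univ, nsmul_eq_mul, hcard,
          Fintype.sum_prod_type]
        simp only [Finset.sum_const, Finset.card_univ, ZMod.card, nsmul_eq_mul]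
        field_simp
    _ = _ := by rw [hHsum, hVsum, mul_add]

end Poincare

/-! ### Slowly varying densities have an extensive intermediate level set -/

section Smearing

variable {L : ℕ} [NeZero L]

/-- The clamp to `[1/16, 3/4]` is `1`-Lipschitz. [folklore] -/
theorem abs_clampBand_sub_le (x y : ℝ) :
    |max (min x (3 / 4)) (1 / 16) - max (min y (3 / 4)) (1 / 16)| ≤ |x - y| := by
  refine (abs_max_sub_max_le_abs _ _ _).trans ?_
  refine (abs_min_sub_min_le_max x (3 / 4) y (3 / 4)).trans ?_
  rw [sub_self, abs_zero, max_eq_left (abs_nonneg _)]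

/-- Across an edge whose endpoint values differ by at most `κ < 11/16`, the clamped values differ
only if one endpoint lies in the middle band `(1/16, 3/4)`:
`|clamp x - clamp y| ≤ κ · (𝟙_{mid}(x) + 𝟙_{mid}(y))`. [folklore] -/
theorem abs_clampBand_sub_le_indicator {x y κ : ℝ} (hκ : κ < 11 / 16) (hxy : |x - y| ≤ κ) :
    |max (min x (3 / 4)) (1 / 16) - max (min y (3 / 4)) (1 / 16)| ≤
      κ * ((if 1 / 16 < x ∧ x < 3 / 4 then (1 : ℝ) else 0) + if 1 / 16 < y ∧ y < 3 / 4 then (1 : ℝ) else 0) := by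
  have hκ0 : 0 ≤ κ := (abs_nonneg _).trans hxy
  by_cases hx : 1 / 16 < x ∧ x < 3 / 4
  · rw [if_pos hx]
    refine ((abs_clampBand_sub_le x y).trans hxy).trans ?_
    split_ifs <;> nlinarith
  · by_cases hy : 1 / 16 < y ∧ y < 3 / 4
    · rw [if_neg hx, if_pos hy]
      refine ((abs_clampBand_sub_le x y).trans hxy).trans ?_
      linarith
    · rw [if_neg hx, if_neg hy, add_zero, mul_zero]
      -- both endpoints on the plateaux: same plateau (else the jump exceeds `κ`)
      have habs := abs_sub_le_iff.1 hxy
      rw [not_and_or, not_lt, not_lt] at hx hy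
      have hval : max (min x (3 / 4)) (1 / 16) = max (min y (3 / 4)) (1 / 16) := by
        rcases hx with hx | hx <;> rcases hy with hy | hy
        · rw [min_eq_left (by linarith : x ≤ 3 / 4), min_eq_left (by linarith : y ≤ 3 / 4),
            max_eq_right hx, max_eq_right hy]
        · exfalso; linarith
        · exfalso; linarith
        · rw [min_eq_right hx, min_eq_right hy]
      rw [hval, sub_self, abs_zero]

/-- **Extensive intermediate level set / extensive smearing.** Let `f : (ℤ/Lℤ)² → [0, 1]` with
`L²/8 ≤ Σ_p f p ≤ L²/2` and `|f(p + eᵢ) - f(p)| ≤ K/L` on every edge of the torus (`0 ≤ K`,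
`2K ≤ L`).  Then `Σ_p f p (1 - f p) ≥ L² / (1502 K + 256)`.
Proof: clamp `f` to `[1/16, 3/4]`; the clamped `g` has total edge variation `≤ 4(K/L)|M|`,
`M = {1/16 < f < 3/4}` (`abs_clampBand_sub_le_indicator`), so by the Poincaré inequality
`Σ|g - ḡ| ≤ 4K|M|`; on the plateaux `A = {f ≥ 3/4}`, `B = {f ≤ 1/16}` one has `g = 3/4`, `g = 1/16`
and `ḡ ∈ [1/16, 3/4]`, so `Σ|g - ḡ| ≥ (11/16) min(|A|, |B|)`; counting (`(3/4)|A| ≤ Σf ≤ L²/2`,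
`Σf ≤ L² - (15/16)|B|`) gives `min(|A|,|B|) ≥ L²/15 - |M|`; hence `|M| ≥ L²/(88K + 15)`, and
`f(1-f) ≥ 15/256` on `M`. [folklore] -/
theorem sum_mul_one_sub_ge_of_lipschitz (f : ZMod L × ZMod L → ℝ) (hf0 : ∀ p, 0 ≤ f p)
    (hf1 : ∀ p, f p ≤ 1) (hlo : (L : ℝ) ^ 2 / 8 ≤ ∑ p, f p) (hhi : ∑ p, f p ≤ (L : ℝ) ^ 2 / 2)
    {K : ℝ} (hK : 0 ≤ K) (hKL : 2 * K ≤ L)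
    (hlip1 : ∀ p : ZMod L × ZMod L, |f (p.1 + 1, p.2) - f p| ≤ K / L)
    (hlip2 : ∀ p : ZMod L × ZMod L, |f (p.1, p.2 + 1) - f p| ≤ K / L) :
    (L : ℝ) ^ 2 / (1502 * K + 256) ≤ ∑ p, f p * (1 - f p) := by
  classical
  have hL : (0 : ℝ) < L := Nat.cast_pos.2 (Nat.pos_of_ne_zero (NeZero.ne L))
  set N : ℝ := (L : ℝ) ^ 2 with hN
  have hNpos : 0 < N := by positivity
  have hcard : (Fintype.card (ZMod L × ZMod L) : ℝ) = N := by
    rw [Fintype.card_prod, ZMod.card, hN]; push_cast; ring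
  set κ : ℝ := K / L with hκ
  have hκ0 : 0 ≤ κ := div_nonneg hK hL.le
  have hκlt : κ < 11 / 16 := by
    rw [hκ, div_lt_iff₀ hL]; linarith
  -- the three level sets as indicator functions
  set iA : ZMod L × ZMod L → ℝ := fun p => if 3 / 4 ≤ f p then 1 else 0 with hiA
  set iB : ZMod L × ZMod L → ℝ := fun p => if f p ≤ 1 / 16 then 1 else 0 with hiB
  set iM : ZMod L × ZMod L → ℝ := fun p => if 1 / 16 < f p ∧ f p < 3 / 4 then 1 else 0 with hiM
  set cA : ℝ := ∑ p, iA p with hcA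
  set cB : ℝ := ∑ p, iB p with hcB
  set cM : ℝ := ∑ p, iM p with hcM
  have hpart : ∀ p, iA p + iB p + iM p = 1 := by
    intro p
    simp only [hiA, hiB, hiM]
    by_cases h1 : 3 / 4 ≤ f p
    · rw [if_pos h1, if_neg (by linarith), if_neg (fun h => by linarith [h.2])]; ring
    · by_cases h2 : f p ≤ 1 / 16
      · rw [if_neg h1, if_pos h2, if_neg (fun h => by linarith [h.1])]; ring
      · rw [if_neg h1, if_neg h2, if_pos ⟨by linarith, by linarith⟩]; ring
  have hsumpart : cA + cB + cM = N := by
    rw [hcA, hcB, hcM, ← Finset.sum_add_distrib, ← Finset.sum_add_distrib]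
    simp only [hpart, Finset.sum_const, Finset.card_univ, nsmul_eq_mul, mul_one, hcard]
  have hiM0 : ∀ p, 0 ≤ iM p := fun p => by simp only [hiM]; split_ifs <;> norm_num
  have hiM1 : ∀ p, iM p ≤ 1 := fun p => by simp only [hiM]; split_ifs <;> norm_num
  have hcM0 : 0 ≤ cM := Finset.sum_nonneg fun p _ => hiM0 p
  -- counting: `(3/4) cA ≤ Σ f` and `Σ f ≤ N - (15/16) cB`
  have hA_le : 3 / 4 * cA ≤ ∑ p, f p := by
    rw [hcA, Finset.mul_sum]
    refine Finset.sum_le_sum fun p _ => ?_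
    simp only [hiA]
    split_ifs with h
    · linarith
    · simp [hf0 p]
  have hB_le : ∑ p, f p ≤ N - 15 / 16 * cB := by
    have h : ∀ p, f p ≤ 1 - 15 / 16 * iB p := fun p => by
      simp only [hiB]
      split_ifs with h
      · linarith
      · linarith [hf1 p]
    calc ∑ p, f p ≤ ∑ p : ZMod L × ZMod L, (1 - 15 / 16 * iB p) := Finset.sum_le_sum fun p _ => h p
      _ = N - 15 / 16 * cB := by
          rw [Finset.sum_sub_distrib, Finset.sum_const, Finset.card_univ, nsmul_eq_mul, mul_one,
            hcard, hcB, Finset.mul_sum]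
  have hminAB : N / 15 - cM ≤ min cA cB := by
    rw [le_min_iff]; constructor <;> linarith
  -- the clamped function and its Poincaré inequality
  set g : ZMod L × ZMod L → ℝ := fun p => max (min (f p) (3 / 4)) (1 / 16) with hg
  set gbar : ℝ := (∑ q, g q) / N with hgbar
  have hglo : ∀ p, 1 / 16 ≤ g p := fun p => le_max_right _ _
  have hghi : ∀ p, g p ≤ 3 / 4 := fun p =>
    max_le (min_le_right _ _) (by norm_num)
  have hgbar_lo : 1 / 16 ≤ gbar := by
    rw [hgbar, le_div_iff₀ hNpos]
    calc 1 / 16 * N = ∑ _p : ZMod L × ZMod L, (1 / 16 : ℝ) := by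
          rw [Finset.sum_const, Finset.card_univ, nsmul_eq_mul, hcard, mul_comm]
      _ ≤ ∑ q, g q := Finset.sum_le_sum fun q _ => hglo q
  have hgbar_hi : gbar ≤ 3 / 4 := by
    rw [hgbar, div_le_iff₀ hNpos]
    calc ∑ q, g q ≤ ∑ _p : ZMod L × ZMod L, (3 / 4 : ℝ) := Finset.sum_le_sum fun q _ => hghi q
      _ = 3 / 4 * N := by rw [Finset.sum_const, Finset.card_univ, nsmul_eq_mul, hcard, mul_comm]
  have hpoinc := torusSq_sum_abs_sub_mean_le g
  -- edge variation of `g` is at most `4 κ cM`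
  have hshift1 : ∑ p : ZMod L × ZMod L, iM (p.1 + 1, p.2) = cM := by
    rw [hcM]
    exact Equiv.sum_comp ((Equiv.addRight (1 : ZMod L)).prodCongr (Equiv.refl (ZMod L))) iM
  have hshift2 : ∑ p : ZMod L × ZMod L, iM (p.1, p.2 + 1) = cM := by
    rw [hcM]
    exact Equiv.sum_comp ((Equiv.refl (ZMod L)).prodCongr (Equiv.addRight (1 : ZMod L))) iM
  have hvar1 : ∑ p : ZMod L × ZMod L, |g (p.1 + 1, p.2) - g p| ≤ 2 * κ * cM := by
    calc ∑ p : ZMod L × ZMod L, |g (p.1 + 1, p.2) - g p|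
        ≤ ∑ p : ZMod L × ZMod L, κ * (iM (p.1 + 1, p.2) + iM p) :=
          Finset.sum_le_sum fun p _ => abs_clampBand_sub_le_indicator hκlt (hlip1 p)
      _ = 2 * κ * cM := by
          rw [← Finset.mul_sum, Finset.sum_add_distrib, hshift1, ← hcM]; ring
  have hvar2 : ∑ p : ZMod L × ZMod L, |g (p.1, p.2 + 1) - g p| ≤ 2 * κ * cM := by
    calc ∑ p : ZMod L × ZMod L, |g (p.1, p.2 + 1) - g p|
        ≤ ∑ p : ZMod L × ZMod L, κ * (iM (p.1, p.2 + 1) + iM p) :=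
          Finset.sum_le_sum fun p _ => abs_clampBand_sub_le_indicator hκlt (hlip2 p)
      _ = 2 * κ * cM := by
          rw [← Finset.mul_sum, Finset.sum_add_distrib, hshift2, ← hcM]; ring
  have hupper : ∑ p, |g p - gbar| ≤ 4 * K * cM := by
    have h4 : (L : ℝ) * (2 * κ * cM + 2 * κ * cM) = 4 * K * cM := by
      rw [hκ]; field_simp; ring
    calc ∑ p, |g p - gbar| ≤ (L : ℝ) * ((∑ p : ZMod L × ZMod L, |g (p.1 + 1, p.2) - g p|) +
          ∑ p : ZMod L × ZMod L, |g (p.1, p.2 + 1) - g p|) := hpoinc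
      _ ≤ (L : ℝ) * (2 * κ * cM + 2 * κ * cM) :=
          mul_le_mul_of_nonneg_left (add_le_add hvar1 hvar2) hL.le
      _ = 4 * K * cM := h4
  -- lower bound on the plateaux
  have hlower : 11 / 16 * min cA cB ≤ ∑ p, |g p - gbar| := by
    have hptA : ∀ p, (3 / 4 - gbar) * iA p ≤ |g p - gbar| := by
      intro p
      simp only [hiA]
      split_ifs with h
      · have hgp : g p = 3 / 4 := by
          simp only [hg]; rw [min_eq_right h, max_eq_left (by norm_num)]
        rw [hgp, mul_one]
        exact le_abs_self _
      · rw [mul_zero]; exact abs_nonneg _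
    have hptB : ∀ p, (gbar - 1 / 16) * iB p ≤ |g p - gbar| := by
      intro p
      simp only [hiB]
      split_ifs with h
      · have hgp : g p = 1 / 16 := by
          simp only [hg]; rw [min_eq_left (by linarith : f p ≤ 3 / 4), max_eq_right h]
        rw [hgp, mul_one, abs_sub_comm]
        exact le_abs_self _
      · rw [mul_zero]; exact abs_nonneg _
    -- `A` and `B` are disjoint, so the two indicator sums can be added inside one sum
    have hdisj : ∀ p, (3 / 4 - gbar) * iA p + (gbar - 1 / 16) * iB p ≤ |g p - gbar| := by
      intro p
      by_cases h : 3 / 4 ≤ f p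
      · have hB0 : iB p = 0 := by simp only [hiB]; rw [if_neg (by linarith)]
        rw [hB0, mul_zero, add_zero]; exact hptA p
      · have hA0 : iA p = 0 := by simp only [hiA]; rw [if_neg h]
        rw [hA0, mul_zero, zero_add]; exact hptB p
    have hsum : (3 / 4 - gbar) * cA + (gbar - 1 / 16) * cB ≤ ∑ p, |g p - gbar| := by
      rw [hcA, hcB, Finset.mul_sum, Finset.mul_sum, ← Finset.sum_add_distrib]
      exact Finset.sum_le_sum fun p _ => hdisj p
    have hmA := mul_le_mul_of_nonneg_left (min_le_left cA cB) (sub_nonneg.2 hgbar_hi)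
    have hmB := mul_le_mul_of_nonneg_left (min_le_right cA cB) (sub_nonneg.2 hgbar_lo)
    linarith
  -- combine: `(11/16)(N/15 - cM) ≤ 4 K cM`, so `cM ≥ N / (88 K + 15)`
  have hcM_ge : N ≤ cM * (88 * K + 15) := by
    have hKc : 0 ≤ K * cM := mul_nonneg hK hcM0
    nlinarith [hminAB, hlower, hupper, hKc]
  -- on `M`, `f (1 - f) ≥ 15/256`
  have hptM : ∀ p, 15 / 256 * iM p ≤ f p * (1 - f p) := by
    intro p
    simp only [hiM]
    split_ifs with h
    · nlinarith [h.1, h.2]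
    · rw [mul_zero]; exact mul_nonneg (hf0 p) (by linarith [hf1 p])
  have hfin : 15 / 256 * cM ≤ ∑ p, f p * (1 - f p) := by
    rw [hcM, Finset.mul_sum]
    exact Finset.sum_le_sum fun p _ => hptM p
  have hkey : N / (1502 * K + 256) ≤ 15 / 256 * cM := by
    rw [div_le_iff₀ (by positivity)]
    have hKc : 0 ≤ K * cM := mul_nonneg hK hcM0
    nlinarith [hcM_ge, hKc]
  exact hkey.trans hfin

/-- **Transfer to `Fin 2 → ZMod L`** (the tree's `TorusSite 2 L`): for `f : (Fin 2 → ZMod L) → [0,1]`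
with `L²/8 ≤ Σ f ≤ L²/2` and `|f(k + eᵢ) - f k| ≤ K/L` for both unit vectors `eᵢ = Pi.single i 1`
(`0 ≤ K`, `2K ≤ L`): `Σ_k f k (1 - f k) ≥ L²/(1502 K + 256)`. [folklore] -/
theorem sum_mul_one_sub_ge_of_lipschitz_pi (f : (Fin 2 → ZMod L) → ℝ) (hf0 : ∀ k, 0 ≤ f k)
    (hf1 : ∀ k, f k ≤ 1) (hlo : (L : ℝ) ^ 2 / 8 ≤ ∑ k, f k) (hhi : ∑ k, f k ≤ (L : ℝ) ^ 2 / 2)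
    {K : ℝ} (hK : 0 ≤ K) (hKL : 2 * K ≤ L)
    (hlip : ∀ (k : Fin 2 → ZMod L) (i : Fin 2), |f (k + Pi.single i 1) - f k| ≤ K / L) :
    (L : ℝ) ^ 2 / (1502 * K + 256) ≤ ∑ k, f k * (1 - f k) := by
  set e := finTwoArrowEquiv (ZMod L) with he
  -- `F p = f ![p.1, p.2]`
  set F : ZMod L × ZMod L → ℝ := fun p => f (e.symm p) with hF
  have hsumF : ∀ φ : ℝ → ℝ, ∑ p, φ (F p) = ∑ k, φ (f k) := fun φ =>
    Equiv.sum_comp e.symm (fun k => φ (f k))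
  have h1 : ∀ p : ZMod L × ZMod L, e.symm (p.1 + 1, p.2) = e.symm p + Pi.single 0 1 := by
    intro p
    ext i
    fin_cases i <;> simp [he, finTwoArrowEquiv]
  have h2 : ∀ p : ZMod L × ZMod L, e.symm (p.1, p.2 + 1) = e.symm p + Pi.single 1 1 := by
    intro p
    ext i
    fin_cases i <;> simp [he, finTwoArrowEquiv]
  have key := sum_mul_one_sub_ge_of_lipschitz F (fun p => hf0 _) (fun p => hf1 _)
    (by rw [hsumF (fun x => x)]; exact hlo) (by rw [hsumF (fun x => x)]; exact hhi) hK hKL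
    (fun p => by simp only [hF]; rw [h1]; exact hlip _ 0)
    (fun p => by simp only [hF]; rw [h2]; exact hlip _ 1)
  rw [hsumF (fun x => x * (1 - x))] at key
  exact key

end Smearing

end Literature.Probability.LatticeModels
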